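/-
Copyright (c) 2026 the pub-hodgecm-mathlib formalisation cell (harness21).  Prover seat hodgecm-mathlib-F0P3a-p08 (g18): road «S3-tree» (architect A-p16 (g30) A-158), T3′ P-2 row
(R2²) «THE FREE ROW, TYPE (2)» (holder A-p19 (g26)), sub-organ (D5) «[T2-c] DISCHARGE AT THE PLACE»; 2026-09-01.
-/
import Literature.NumberTheory.Automorphic.QuadraticRamifiedOrderNormIndex        -- ★ p846601 (A-p19): [T2-c] layer 3 `relIndex_units_comap_norm_eq`
import Literature.NumberTheory.Automorphic.SplitTorusOrderFixedSidePlace           -- ★ Σ2-CM (A-p19): the place dictionary `exists_integer_ringHom_toPlace`, `exists_map_eq_of_galAdicCompletionMap_eq`, `exists_isUnit_galAdicCompletionMap_sub`, `natCard_residueField_eq_natCard_residueField_sq`, `natCard_residueField_eq_absNorm`; brings ★ `ValuedFieldValuativeRelBridge`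
import Literature.NumberTheory.LocalFields.UnramifiedQuadraticNormAtInertPlace     -- ★ `exists_mul_galAdicCompletionMap_eq_of_inert` (unit norms at an inert place)
import Literature.NumberTheory.Automorphic.Liu2021.LemD1AsPrintedIndexedNonVacuityInertCofinite   -- ★ `valued_toPlace_of_isUnramifiedIn`
import Literature.NumberTheory.Automorphic.UnitaryGroupSplitPlace                  -- ★ `algEquiv_mul_self_eq_one`
import HarnessLib

/-!
# T3′ P-2 row (R2²), sub-organ (D5) «[T2-c] DISCHARGE AT THE PLACE»: the type-(2) unit index `[C : R^×] = (N(v)+1)·N(v)^{N+n−1}` read at an inert place `w ∣ v`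
# over the ramified eigen-field `K = E_w(√d)`

Topic `NumberTheory/Rogawski1990`; namespace `Literature.NumberTheory.Rogawski1990`.  THEOREMS ONLY (no definition, no instance, no notation, no named fact, no `sorry`); kernel lane
`--supports stmt-HodgeConjecture-24833`.  Cell `pub/hodgecm-mathlib` (D-0151), crux H413; road «S3-tree», T3′ «depth-zero κ-transfer», P-2 row (R2²) «THE FREE ROW, TYPE (2)» (holder
A-p19 (g26), head [T2-d]; architect A-p16 (g30) A-145∕A-158), sub-organ **(D5)**: the PLACE TWIN of ★ Σ2-CM `relIndex_units_adjoin_comap_norm_eq_place` (type (1)) for the type-(2) order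
★ `relIndex_units_comap_norm_eq` ([T2-c] layer 3, A-p19 p846601).  Pure plumbing: every dictionary binder of the generic head (`ιO σO j σ₁ θ k₀F`, `hσσ hσι hfixO hιinj hιu hσ₁j hσ₁θ
hθ hk₀ hcoord`, `u t y D e₂ lam h2 hD hlam hu1 ht2 hσu hσD hσt hσy`, `hnormE hnorm₁`, `ϖF ϖ hιϖ hn hN hq hξ`) is discharged at `F_v ⊂ E_w` (`ι = toPlace v w`, `σ = galAdicCompletionMap c hw`,
`v` unramified, `c • w = w`) with `O₁ := 𝒪[K]`, `K := M_{w₁}` the completion of a quadratic extension `M ⊃ E` at `w₁ ∣ w` (`ι₁ = toPlace w w₁`), GIVEN as HYPOTHESES the outputs of ★ (D2-β)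
`exists_eigenField_package` (`θ = √(ι k₀)`, the involution `s̃` over `σ` fixing `θ`, Eisenstein coordinates, integrality, isometry, unit norms (nK)) and the type-(2) eigen-data
`u t D y e₂ ∈ E_w` of ★ (D1).  OUTPUT: the integral ring maps `ιO σO jO σ₁O`, the integral lifts `uO tO yO DO e₂O lamO` with their coercion identities, and the INDEX
`[C : R^×] = (N(v) + 1)·N(v)^{N+n−1}` for `R = 𝒪_w[(u, λ₁)] ≤ 𝒪_w × 𝒪[K]`, `C = {c : c·c⋆ ∈ R^×}` — the ROW-2 value of the free type-(2) class.
HONEST LABEL: HC_CM is proved only modulo the 2 remaining named inputs (hLiu418 24832, h413 24833) until rung 0 closes; unconditional local algebra, count-neutral.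

* **`exists_integers_relIndex_units_comap_norm_eq_place`** — (D5).

## References
* [Rogawski1990] J. D. Rogawski, *Automorphic Representations of Unitary Groups in Three Variables* (1990): §4.9 Lemma 4.9.3 p. 56, Prop. 4.9.1 (b) p. 55.
* [SerreLocalFields1979] J.-P. Serre, *Local Fields*, GTM 67 (1979): Ch. II §1–§3; Ch. V §2 Prop. 3 and Corollary.
* [Neukirch1999] J. Neukirch, *Algebraic Number Theory*, Grundlehren 322 (1999): Ch. I §12; Ch. II §4 Prop. (4.3).
-/

set_option autoImplicit false

noncomputable section

open ValuativeRel NumberField IsDedekindDomain Polynomial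
open scoped ValuativeRel
open Literature.NumberTheory.Automorphic Literature.NumberTheory.Automorphic.UnitaryGroup

namespace Literature.NumberTheory.Rogawski1990

/-- An endomorphism of a valued field preserving the valuation ring restricts to a ring endomorphism of `𝒪` (coercion identity exported). [cite: SerreLocalFields1979, Ch. II §1] -/
theorem exists_integer_ringHom_of_map_mem_integer {K : Type*} [Field K] [ValuativeRel K] (f : K →+* K) (hf : ∀ z : 𝒪[K], f z ∈ 𝒪[K]) :
    ∃ fO : 𝒪[K] →+* 𝒪[K], ∀ z : 𝒪[K], ((fO z : 𝒪[K]) : K) = f z :=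
  ⟨f.restrict 𝒪[K] 𝒪[K] fun z hz => hf ⟨z, hz⟩, fun _ => rfl⟩

set_option maxHeartbeats 4000000 in
/-- **(D5) «[T2-c] DISCHARGE AT THE PLACE»** — see the module docstring.  Frame: `E ∕ F` quadratic number fields, `c ≠ 1`, `v` unramified in `E`, `w ∣ v` with `c • w = w`, `|2|_w = 1`;
`K = M_{w₁}` for a quadratic `M ⊃ E` ramified at `w` with the (D2-β) package `(θ, s̃)` over `d = ι k₀`; eigen-data `u t D y e₂`.
[cite: Rogawski1990, §4.9 Lemma 4.9.3 p. 56; Prop. 4.9.1 (b) p. 55] [cite: SerreLocalFields1979, Ch. V §2 Prop. 3 and Corollary] [cite: Neukirch1999, Ch. I §12] -/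
theorem exists_integers_relIndex_units_comap_norm_eq_place
    {F E : Type} [Field F] [NumberField F] [Field E] [NumberField E] [Algebra F E] [Algebra.IsQuadraticExtension F E]
    (c : E ≃ₐ[F] E) (v : HeightOneSpectrum (𝓞 F)) (hc : c ≠ 1) (hunr : Algebra.IsUnramifiedIn (𝓞 E) v.asIdeal)
    (w : PlacesOver E v) (hw : c • w.1 = w.1) (h2 : Valued.v (2 : w.1.adicCompletion E) = 1)
    -- the ramified eigen-field `K = M_{w₁}` and its (D2-β) package over `d = ι k₀`
    {M : Type} [Field M] [NumberField M] [Algebra E M] (w₁ : PlacesOver M w.1)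
    {k₀ : v.adicCompletion F} (hk₀ : Valued.v k₀ = WithZero.exp (-1 : ℤ))
    {θ : w₁.1.adicCompletion M} (s' : w₁.1.adicCompletion M →+* w₁.1.adicCompletion M)
    (hθ : θ ^ 2 = toPlace w.1 w₁ (toPlace v w k₀))
    (hcoord : ∀ z : w₁.1.adicCompletion M, ∃! pq : w.1.adicCompletion E × w.1.adicCompletion E, z = toPlace w.1 w₁ pq.1 + toPlace w.1 w₁ pq.2 * θ)
    (hint : ∀ p q : w.1.adicCompletion E, toPlace w.1 w₁ p + toPlace w.1 w₁ q * θ ∈ 𝒪[w₁.1.adicCompletion M] ↔ p ∈ 𝒪[w.1.adicCompletion E] ∧ q ∈ 𝒪[w.1.adicCompletion E])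
    (hs'ι : ∀ x, s' (toPlace w.1 w₁ x) = toPlace w.1 w₁ (galAdicCompletionMap (L := E) c hw x)) (hs'θ : s' θ = θ) (_hs's' : ∀ z, s' (s' z) = z)
    (hs'O : ∀ z : 𝒪[w₁.1.adicCompletion M], s' z ∈ 𝒪[w₁.1.adicCompletion M]) (hs'v : ∀ z, Valued.v (s' z) = Valued.v z)
    (hnorm1 : ∀ c₁ : w₁.1.adicCompletion M, c₁ ≠ 0 → s' c₁ = c₁ → Even (WithZero.log (Valued.v c₁)) → ∃ a : w₁.1.adicCompletion M, a * s' a * c₁ = 1)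
    -- the type-(2) eigen-data of a deep match
    (u t D y e₂ : w.1.adicCompletion E) (hu1 : Valued.v (u - 1) < 1) (ht2 : Valued.v (t - 2) < 1) (h2e : e₂ * 2 = 1)
    (hD : 4 * D = t * t - y * y * toPlace v w k₀)
    (hσu : u * galAdicCompletionMap (L := E) c hw u = 1) (hσD : D * galAdicCompletionMap (L := E) c hw D = 1)
    (hσt : galAdicCompletionMap (L := E) c hw t = t * galAdicCompletionMap (L := E) c hw D)
    (hσy : galAdicCompletionMap (L := E) c hw y = -(y * galAdicCompletionMap (L := E) c hw D))
    {n N : ℕ} (hn : Valued.v (u * u - t * u + D) = WithZero.exp (-(n : ℤ))) (hN : Valued.v y = WithZero.exp (-(N : ℤ))) (hNn : 1 ≤ N + n) :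
    ∃ (ιO : 𝒪[v.adicCompletion F] →+* 𝒪[w.1.adicCompletion E]) (σO : 𝒪[w.1.adicCompletion E] →+* 𝒪[w.1.adicCompletion E]) (jO : 𝒪[w.1.adicCompletion E] →+* 𝒪[w₁.1.adicCompletion M]) (σ₁O : 𝒪[w₁.1.adicCompletion M] →+* 𝒪[w₁.1.adicCompletion M])
      (uO tO yO DO e₂O : 𝒪[w.1.adicCompletion E]) (lamO : 𝒪[w₁.1.adicCompletion M]),
      (∀ x : 𝒪[v.adicCompletion F], ((ιO x : 𝒪[w.1.adicCompletion E]) : w.1.adicCompletion E) = toPlace v w x) ∧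
      (∀ x : 𝒪[w.1.adicCompletion E], ((σO x : 𝒪[w.1.adicCompletion E]) : w.1.adicCompletion E) = galAdicCompletionMap (L := E) c hw x) ∧
      (∀ x : 𝒪[w.1.adicCompletion E], ((jO x : 𝒪[w₁.1.adicCompletion M]) : w₁.1.adicCompletion M) = toPlace w.1 w₁ x) ∧
      (∀ z : 𝒪[w₁.1.adicCompletion M], ((σ₁O z : 𝒪[w₁.1.adicCompletion M]) : w₁.1.adicCompletion M) = s' z) ∧
      (uO : w.1.adicCompletion E) = u ∧ (tO : w.1.adicCompletion E) = t ∧ (yO : w.1.adicCompletion E) = y ∧ (DO : w.1.adicCompletion E) = D ∧ (e₂O : w.1.adicCompletion E) = e₂ ∧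
      (lamO : w₁.1.adicCompletion M) = (toPlace w.1 w₁ t + toPlace w.1 w₁ y * θ) * toPlace w.1 w₁ e₂ ∧
      (Units.map ((Polynomial.eval₂RingHom (RingHom.prod (RingHom.id 𝒪[w.1.adicCompletion E]) jO) ((uO, lamO) : 𝒪[w.1.adicCompletion E] × 𝒪[w₁.1.adicCompletion M])).range.subtype :
          (Polynomial.eval₂RingHom (RingHom.prod (RingHom.id 𝒪[w.1.adicCompletion E]) jO) ((uO, lamO) : 𝒪[w.1.adicCompletion E] × 𝒪[w₁.1.adicCompletion M])).range →* 𝒪[w.1.adicCompletion E] × 𝒪[w₁.1.adicCompletion M])).range.relIndex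
        ((Units.map ((Polynomial.eval₂RingHom (RingHom.prod (RingHom.id 𝒪[w.1.adicCompletion E]) jO) ((uO, lamO) : 𝒪[w.1.adicCompletion E] × 𝒪[w₁.1.adicCompletion M])).range.subtype :
          (Polynomial.eval₂RingHom (RingHom.prod (RingHom.id 𝒪[w.1.adicCompletion E]) jO) ((uO, lamO) : 𝒪[w.1.adicCompletion E] × 𝒪[w₁.1.adicCompletion M])).range →* 𝒪[w.1.adicCompletion E] × 𝒪[w₁.1.adicCompletion M])).range.comap
          (MonoidHom.id (𝒪[w.1.adicCompletion E] × 𝒪[w₁.1.adicCompletion M])ˣ * Units.map (RingHom.prodMap σO σ₁O : 𝒪[w.1.adicCompletion E] × 𝒪[w₁.1.adicCompletion M] →* 𝒪[w.1.adicCompletion E] × 𝒪[w₁.1.adicCompletion M]))) =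
        (Ideal.absNorm v.asIdeal + 1) * Ideal.absNorm v.asIdeal ^ (N + n - 1) := by
  -- ### 0. Notation-free abbreviations and the valuation bridges
  have hι₁inj : Function.Injective (toPlace w.1 w₁) := (toPlace w.1 w₁).injective
  have hσv : ∀ x : w.1.adicCompletion E, Valued.v (galAdicCompletionMap (L := E) c hw x) = Valued.v x :=
    fun x => valued_galAdicCompletionMap (L := E) c hw x
  have hιv : ∀ y : v.adicCompletion F, Valued.v (toPlace v w y) = Valued.v y :=
    fun y => Literature.NumberTheory.Automorphic.Liu2021.LemD1IndexedNonVacuityInertCofinite.valued_toPlace_of_isUnramifiedIn E v hunr w y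
  have hσσK : ∀ x : w.1.adicCompletion E, galAdicCompletionMap (L := E) c hw (galAdicCompletionMap (L := E) c hw x) = x :=
    galAdicCompletionMap_galAdicCompletionMap_of_smul_eq c w hc hw
  have hcc : c * c = 1 := algEquiv_mul_self_eq_one (F := F) hc
  -- squares in `ℤᵐ⁰`: `x·x = 1 → x = 1`
  have hsq : ∀ x : WithZero (Multiplicative ℤ), x * x = 1 → x = 1 := fun x h => by
    rcases eq_or_ne x 0 with h0 | h0
    · rw [h0, zero_mul] at h; exact absurd h zero_ne_one
    · rw [← WithZero.exp_log h0, ← WithZero.exp_add, WithZero.exp_eq_one] at h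
      rw [← WithZero.exp_log h0, show WithZero.log x = 0 by omega, WithZero.exp_zero]
  -- units and the maximal ideal of a `ValuativeRel` valuation ring, read on `Valued.v`
  have hunitE : ∀ x : 𝒪[w.1.adicCompletion E], IsUnit x ↔ Valued.v (x : w.1.adicCompletion E) = 1 := fun x => by
    rw [(Valuation.integer.integers (valuation (w.1.adicCompletion E))).isUnit_iff_valuation_eq_one, v_eq_one_iff_valuation_eq_one]; rfl
  have hunitF : ∀ x : 𝒪[v.adicCompletion F], IsUnit x ↔ Valued.v (x : v.adicCompletion F) = 1 := fun x => by
    rw [(Valuation.integer.integers (valuation (v.adicCompletion F))).isUnit_iff_valuation_eq_one, v_eq_one_iff_valuation_eq_one]; rfl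
  have hunitK : ∀ x : 𝒪[w₁.1.adicCompletion M], IsUnit x ↔ Valued.v (x : w₁.1.adicCompletion M) = 1 := fun x => by
    rw [(Valuation.integer.integers (valuation (w₁.1.adicCompletion M))).isUnit_iff_valuation_eq_one, v_eq_one_iff_valuation_eq_one]; rfl
  have hmaxE : ∀ x : 𝒪[w.1.adicCompletion E], Valued.v (x : w.1.adicCompletion E) < 1 → x ∈ IsLocalRing.maximalIdeal 𝒪[w.1.adicCompletion E] :=
    fun x hx => by rw [IsLocalRing.mem_maximalIdeal, mem_nonunits_iff, hunitE]; exact hx.ne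
  -- ### 1. Integrality of the data
  have hle_of_sub : ∀ {x c₀ : w.1.adicCompletion E}, Valued.v (x - c₀) < 1 → Valued.v c₀ ≤ 1 → Valued.v x ≤ 1 := fun {x c₀} hx hc₀ => by
    have := Valued.v.map_add_le hx.le hc₀; rwa [sub_add_cancel] at this
  have huO : u ∈ 𝒪[w.1.adicCompletion E] := (v_le_one_iff_mem_integer u).1 (hle_of_sub hu1 (by rw [map_one]))
  have htO : t ∈ 𝒪[w.1.adicCompletion E] := (v_le_one_iff_mem_integer t).1 (hle_of_sub ht2 h2.le)
  have hDv : Valued.v D = 1 := hsq _ (by have h := congrArg Valued.v hσD; rwa [map_mul, hσv, map_one] at h)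
  have hDO : D ∈ 𝒪[w.1.adicCompletion E] := (v_le_one_iff_mem_integer D).1 hDv.le
  have hyO : y ∈ 𝒪[w.1.adicCompletion E] := (v_le_one_iff_mem_integer y).1 (by
    rw [hN, ← WithZero.exp_zero]; exact WithZero.exp_le_exp.2 (by omega))
  have he₂v : Valued.v e₂ = 1 := by
    have h := congrArg Valued.v h2e; rw [map_mul, h2, mul_one, map_one] at h; exact h
  have he₂O : e₂ ∈ 𝒪[w.1.adicCompletion E] := (v_le_one_iff_mem_integer e₂).1 he₂v.le
  have hk₀O : k₀ ∈ 𝒪[v.adicCompletion F] := (v_le_one_iff_mem_integer k₀).1 (by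
    rw [hk₀, ← WithZero.exp_zero]; exact WithZero.exp_le_exp.2 (by norm_num))
  have hθO : θ ∈ 𝒪[w₁.1.adicCompletion M] := by
    have h := (hint 0 1).2 ⟨zero_mem _, one_mem _⟩
    rwa [map_zero, map_one, zero_add, one_mul] at h
  -- ### 2. The integral ring maps
  obtain ⟨ιO, hιO⟩ := exists_integer_ringHom_toPlace v w
  obtain ⟨jO, hjO⟩ := exists_integer_ringHom_toPlace w.1 w₁
  obtain ⟨σO, hσO⟩ := exists_integer_ringHom_of_map_mem_integer (galAdicCompletionMap (L := E) c hw) (mem_integer_galAdicCompletionMap c v w hw)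
  obtain ⟨σ₁O, hσ₁O⟩ := exists_integer_ringHom_of_map_mem_integer s' hs'O
  -- the integral lifts (opaque, with their coercion identities)
  obtain ⟨uO, huO'⟩ : ∃ uO : 𝒪[w.1.adicCompletion E], (uO : w.1.adicCompletion E) = u := ⟨⟨u, huO⟩, rfl⟩
  obtain ⟨tO, htO'⟩ : ∃ tO : 𝒪[w.1.adicCompletion E], (tO : w.1.adicCompletion E) = t := ⟨⟨t, htO⟩, rfl⟩
  obtain ⟨yO, hyO'⟩ : ∃ yO : 𝒪[w.1.adicCompletion E], (yO : w.1.adicCompletion E) = y := ⟨⟨y, hyO⟩, rfl⟩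
  obtain ⟨DO, hDO'⟩ : ∃ DO : 𝒪[w.1.adicCompletion E], (DO : w.1.adicCompletion E) = D := ⟨⟨D, hDO⟩, rfl⟩
  obtain ⟨e₂O, he₂O'⟩ : ∃ e₂O : 𝒪[w.1.adicCompletion E], (e₂O : w.1.adicCompletion E) = e₂ := ⟨⟨e₂, he₂O⟩, rfl⟩
  obtain ⟨θO, hθO'⟩ : ∃ θO : 𝒪[w₁.1.adicCompletion M], (θO : w₁.1.adicCompletion M) = θ := ⟨⟨θ, hθO⟩, rfl⟩
  obtain ⟨k₀F, hk₀F'⟩ : ∃ k₀F : 𝒪[v.adicCompletion F], (k₀F : v.adicCompletion F) = k₀ := ⟨⟨k₀, hk₀O⟩, rfl⟩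
  obtain ⟨lamO, hlamOdef⟩ : ∃ lamO : 𝒪[w₁.1.adicCompletion M], lamO = jO (e₂O * tO) + jO (e₂O * yO) * θO := ⟨_, rfl⟩
  have hlamO : (lamO : w₁.1.adicCompletion M) = (toPlace w.1 w₁ t + toPlace w.1 w₁ y * θ) * toPlace w.1 w₁ e₂ := by
    rw [hlamOdef, Subring.coe_add, Subring.coe_mul, hjO, hjO, Subring.coe_mul, Subring.coe_mul, map_mul, map_mul, he₂O', htO', hyO', hθO']
    ring
  -- ### 3. The dictionary binders of ★ `relIndex_units_comap_norm_eq`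
  have hσσ : ∀ x, σO (σO x) = x := fun x => Subtype.ext (by rw [hσO, hσO, hσσK])
  have hσι : ∀ y', σO (ιO y') = ιO y' := fun y' => Subtype.ext (by rw [hσO, hιO, galAdicCompletionMap_toPlace c w w hw])
  have hfixO : ∀ x, σO x = x → ∃ y', ιO y' = x := fun x hx =>
    exists_map_eq_of_galAdicCompletionMap_eq v w c hc hw ιO hιO x (by rw [← hσO, hx])
  have hιinj : Function.Injective ιO := injective_of_coe_eq_toPlace v w ιO hιO
  have hιu : ∀ y', IsUnit (ιO y') → IsUnit y' := fun y' h => by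
    rw [hunitF]; rw [hunitE, hιO, hιv] at h; exact h
  have hσ₁j : ∀ x, σ₁O (jO x) = jO (σO x) := fun x => Subtype.ext (by rw [hσ₁O, hjO, hjO, hσO, hs'ι])
  have hσ₁θ : σ₁O θO = θO := Subtype.ext (by rw [hσ₁O, hθO']; exact hs'θ)
  have hθ' : θO ^ 2 = jO (ιO k₀F) := Subtype.ext (by rw [Subring.coe_pow, hjO, hιO, hθO', hk₀F']; exact hθ)
  have hk₀' : k₀F ∈ IsLocalRing.maximalIdeal 𝒪[v.adicCompletion F] := by
    rw [IsLocalRing.mem_maximalIdeal, mem_nonunits_iff, hunitF, hk₀F', hk₀, ← WithZero.exp_zero, WithZero.exp_inj]; norm_num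
  have hcoordO : ∀ z : 𝒪[w₁.1.adicCompletion M], ∃! bc : 𝒪[w.1.adicCompletion E] × 𝒪[w.1.adicCompletion E], z = jO bc.1 + jO bc.2 * θO := by
    intro z
    obtain ⟨⟨p, q⟩, hz, huniq⟩ := hcoord (z : w₁.1.adicCompletion M)
    have hpq : p ∈ 𝒪[w.1.adicCompletion E] ∧ q ∈ 𝒪[w.1.adicCompletion E] := (hint p q).1 (hz ▸ z.2)
    refine ⟨(⟨p, hpq.1⟩, ⟨q, hpq.2⟩), Subtype.ext ?_, fun bc hbc => ?_⟩
    · rw [Subring.coe_add, Subring.coe_mul, hjO, hjO, hθO']; exact hz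
    · have hbc' : (z : w₁.1.adicCompletion M) = toPlace w.1 w₁ bc.1 + toPlace w.1 w₁ bc.2 * θ := by
        have := congrArg (fun x : 𝒪[w₁.1.adicCompletion M] => (x : w₁.1.adicCompletion M)) hbc
        simp only [Subring.coe_add, Subring.coe_mul, hjO, hθO'] at this
        exact this
      have h := huniq (((bc.1 : w.1.adicCompletion E)), (bc.2 : w.1.adicCompletion E)) hbc'
      rw [Prod.mk.injEq] at h
      exact Prod.ext (Subtype.ext h.1) (Subtype.ext h.2)
  have h2' : e₂O * 2 = 1 := Subtype.ext (by push_cast; rw [he₂O']; exact h2e)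
  have hD' : 4 * DO = tO * tO - yO * yO * ιO k₀F := Subtype.ext (by push_cast; rw [hιO, hDO', htO', hyO', hk₀F']; exact hD)
  have hu1' : uO - 1 ∈ IsLocalRing.maximalIdeal 𝒪[w.1.adicCompletion E] := hmaxE _ (by push_cast; rw [huO']; exact hu1)
  have ht2' : tO - 2 ∈ IsLocalRing.maximalIdeal 𝒪[w.1.adicCompletion E] := hmaxE _ (by push_cast; rw [htO']; exact ht2)
  have hσu' : uO * σO uO = 1 := Subtype.ext (by rw [Subring.coe_mul, hσO, huO', Subring.coe_one]; exact hσu)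
  have hσD' : DO * σO DO = 1 := Subtype.ext (by rw [Subring.coe_mul, hσO, hDO', Subring.coe_one]; exact hσD)
  have hσt' : σO tO = tO * σO DO := Subtype.ext (by rw [hσO, Subring.coe_mul, hσO, htO', hDO']; exact hσt)
  have hσy' : σO yO = -(yO * σO DO) := Subtype.ext (by rw [hσO, Subring.coe_neg, Subring.coe_mul, hσO, hyO', hDO']; exact hσy)
  have hnormE : ∀ a : 𝒪[w.1.adicCompletion E], IsUnit a → σO a = a → ∃ b, b * σO b = a := fun a ha hσa => by
    obtain ⟨b, hb⟩ := LocalFields.UnramifiedQuadraticNorm.exists_mul_galAdicCompletionMap_eq_of_inert c v hc hcc hunr w hw a ha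
      (by have := congrArg (fun x : 𝒪[w.1.adicCompletion E] => (x : w.1.adicCompletion E)) hσa; rwa [hσO] at this)
    exact ⟨b, Subtype.ext (by rw [Subring.coe_mul, hσO]; exact hb)⟩
  have hnorm₁ : ∀ z : 𝒪[w₁.1.adicCompletion M], IsUnit z → σ₁O z = z → ∃ w', w' * σ₁O w' = z := fun z hz hσz => by
    have hz1 : Valued.v (z : w₁.1.adicCompletion M) = 1 := (hunitK z).1 hz
    have hz0 : (z : w₁.1.adicCompletion M) ≠ 0 := fun h0 => by rw [h0, map_zero] at hz1; exact zero_ne_one hz1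
    have hσz' : s' (z : w₁.1.adicCompletion M) = z := by
      have := congrArg (fun x : 𝒪[w₁.1.adicCompletion M] => (x : w₁.1.adicCompletion M)) hσz; rwa [hσ₁O] at this
    obtain ⟨a, ha⟩ := hnorm1 z hz0 hσz' (by rw [hz1, WithZero.log_one]; exact ⟨0, rfl⟩)
    have hav : Valued.v a = 1 := hsq _ (by
      have h := congrArg Valued.v ha
      rwa [map_mul, map_mul, hs'v, hz1, mul_one, map_one] at h)
    have ha0 : a ≠ 0 := fun h0 => by rw [h0, map_zero] at hav; exact zero_ne_one hav
    have haO : a⁻¹ ∈ 𝒪[w₁.1.adicCompletion M] := (v_le_one_iff_mem_integer _).1 (by rw [map_inv₀, hav, inv_one])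
    refine ⟨⟨a⁻¹, haO⟩, Subtype.ext ?_⟩
    rw [Subring.coe_mul, hσ₁O]
    change a⁻¹ * s' a⁻¹ = (z : w₁.1.adicCompletion M)
    rw [map_inv₀, ← mul_inv, ← mul_right_inj' (mul_ne_zero ha0 ((map_ne_zero s').2 ha0)), mul_inv_cancel₀ (mul_ne_zero ha0 ((map_ne_zero s').2 ha0)), ha]
  -- uniformisers, valuations of the eigen-data
  have hϖF : IsUniformizingElement k₀ := isUniformizingElement_of_v_eq hk₀
  have hιk₀ : Valued.v (toPlace v w k₀) = WithZero.exp (-1 : ℤ) := by rw [hιv, hk₀]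
  have hϖ : IsUniformizingElement (toPlace v w k₀) := isUniformizingElement_of_v_eq hιk₀
  have hιϖ : ιO ⟨k₀, hϖF.mem⟩ = ⟨toPlace v w k₀, hϖ.mem⟩ := Subtype.ext (hιO _)
  have hk₀F'' : k₀F = ⟨k₀, hϖF.mem⟩ := Subtype.ext hk₀F'
  have hpow : ∀ m : ℕ, Valued.v (toPlace v w k₀ ^ m) = WithZero.exp (-(m : ℤ)) := fun m => by
    rw [map_pow, hιk₀, ← WithZero.exp_nsmul]; congr 1; simp
  have hn' : valuation (w.1.adicCompletion E) ((uO * uO - tO * uO + DO : 𝒪[w.1.adicCompletion E]) : w.1.adicCompletion E) =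
      valuation (w.1.adicCompletion E) (toPlace v w k₀) ^ n := by
    rw [← map_pow, ← v_eq_iff_valuation_eq, hpow]; push_cast; rw [huO', htO', hDO']; exact hn
  have hN' : valuation (w.1.adicCompletion E) ((yO : 𝒪[w.1.adicCompletion E]) : w.1.adicCompletion E) = valuation (w.1.adicCompletion E) (toPlace v w k₀) ^ N := by
    rw [← map_pow, ← v_eq_iff_valuation_eq, hpow, hyO']; exact hN
  have hq : Nat.card 𝓀[w.1.adicCompletion E] = Nat.card 𝓀[v.adicCompletion F] ^ 2 := natCard_residueField_eq_natCard_residueField_sq c v hc hunr w hw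
  obtain ⟨ξ, hξ0⟩ := exists_isUnit_galAdicCompletionMap_sub c v hc hunr w hw
  have hξ : IsUnit (ξ - σO ξ) := by
    have h := hξ0.neg
    rw [neg_sub] at h
    have hσOξ : σO ξ = ⟨galAdicCompletionMap (L := E) c hw ξ, mem_integer_galAdicCompletionMap c v w hw ξ⟩ := Subtype.ext (hσO ξ)
    rw [hσOξ]
    exact h
  -- ### 4. Assembly
  refine ⟨ιO, σO, jO, σ₁O, uO, tO, yO, DO, e₂O, lamO, hιO, hσO, hjO, hσ₁O, huO', htO', hyO', hDO', he₂O', hlamO, ?_⟩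
  rw [← natCard_residueField_eq_absNorm v]
  exact relIndex_units_comap_norm_eq ιO σO jO σ₁O θO hσσ hσι hfixO hιinj hιu hσ₁j hσ₁θ hθ' hk₀' hcoordO uO h2' hD' hlamOdef hu1' ht2' hσu' hσD' hσt' hσy'
    hnormE hnorm₁ hϖF hϖ hιϖ hn' hN' hq hξ hNn

end Literature.NumberTheory.Rogawski1990

end
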